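import Literature.NumberTheory.Sieve.NairTenenbaumShortSums
import HarnessLib

/-!
# Nair–Tenenbaum 1998, Theorem 1 AS PRINTED (the corrected named fact)

M. Nair, G. Tenenbaum, *Short sums of certain arithmetic functions*, Acta Math. 180 (1998),
119–144, Theorem 1 (p. 125), in the case of pairwise coprime irreducible `Qⱼ` (`k = r`).

The tree's first rendering `NairTenenbaum1998_theorem1` (`NairTenenbaumShortSums.lean`) transcribes
K. Henriot's paraphrase with the range `0 < α < 1`, which OVER-CLAIMS (Erratum 2 of that file: the
printed `0 < ε < 1/(8g²)`, class `𝓜_k(A, B, ⅓εδ)`, `x^{4g²ε} ≤ y ≤ x` is `0 < α < 1/2` under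
`α = 4g²ε`).  That erratum spells out the faithful statement as the HYPOTHESIS of the proved
`NairTenenbaum1998_theorem1.henriotForm_of_printed` and leaves the corrected NAMED fact to a
definition proposal (D-0026).  This file is that proposal: `NairTenenbaum1998_theorem1_printed` is
that hypothesis VERBATIM (so `henriotForm_of_printed` applies to it by `fun h => … h`), together
with the bridge already proved there:

* `NairTenenbaum1998_theorem1_printed.henriotForm` — the printed theorem yields Henriot's form
  (the body of `NairTenenbaum1998_theorem1`) on EXACTLY the range `0 < α < 1/2`
  (the converse direction, old Prop ⇒ printed with strict `x^{4g²ε} < y`, is the landed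
  `NairTenenbaum1998_theorem1.printedForm_strict`).

Consumers that only need `α < 1/2` (e.g. the long-sum applications `y = x`, `α = 1/4` of the
`SelbergDelangeRigidity` tails, `Summits/Parity/BatemanHorn/Theorems/…TailsTwoEngine.lean`) should
take `NairTenenbaum1998_theorem1_printed` as their named hypothesis, not the misstated Prop.
Unproved here (a NAMED FACT); the proof is op. cit. §§3–4 (pp. 127–140).

## References

* [NairTenenbaum1998] M. Nair, G. Tenenbaum, Acta Math. 180 (1998), Theorem 1 p. 125; (1) p. 119
  (class `𝓜_k`); (16) p. 124 (`v(n; F, ρ)`); §2 p. 123 (`ρ`, `‖Q‖`, fixed prime divisor, `D`).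
* [Henriot2012] K. Henriot, Math. Proc. Cambridge Philos. Soc. 152 (2012), 405–424, Thm. 1
  (paraphrase of Theorem 1; range corrected in `NairTenenbaumShortSums`, Erratum 2).
-/

noncomputable section

open Polynomial Finset Real

namespace Literature.NumberTheory.Sieve

/-- **Nair–Tenenbaum 1998, Theorem 1 (p. 125), as printed**, for pairwise coprime irreducible
`Qⱼ` (`k = r`): "THEOREM 1. Let `k` be an arbitrary positive integer and let `Qⱼ ∈ ℤ[X]`
(`1 ≤ j ≤ k`) be such that `Q = ∏ⱼ Qⱼ` has no fixed prime divisor.  Denote by `g` the degree of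
`Q`, by `r` the number of irreducible factors of `Q` and put `ρ = ρ_Q`.  Then for any `A ≥ 1`,
`B ≥ 1`, `0 < ε < 1/8g²`, `0 < δ < 1` and `F ∈ 𝓜_k(A, B, ⅓εδ)` we have
`∑_{x<n≤x+y} F(|Q₁(n)|, …, |Q_k(n)|) ≪ y ∏_{p≤x} (1 − ρ(p)/p) ∑_{n≤x} v(n; F, ρ)`  (18)
uniformly for `x ≥ c₀‖Q‖^δ` and `x^{4g²ε} ≤ y ≤ x`.  The implicit constant in the `≪`-sign
depends at most on `A, B, ε, δ, k, r, g, D` and the constant `c₀` depends at most on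
`A, B, ε, δ, k, r` and `g`."  Here `v(n; F, ρ) = ∑†_{n₁⋯n_k = n} F(n₁, …, n_k) ∏ⱼ ρ_{Qⱼ}(nⱼ)/nⱼ`
((16) p. 124).  RENDERING — identical to the hypothesis `h` of
`NairTenenbaum1998_theorem1.henriotForm_of_printed` (verbatim; see that docstring for what a
reviewer must accept): `c₀` and `C` are chosen after `(k, g, D, A, B, ε, δ)` and before
`Q, F, x, y`, with `D = (∏ Qⱼ).discr` (of which the printed `D` is one of finitely many divisors,
`r = k`, so the printed constants may be maximised; letting `c₀` depend on `D` is weaker than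
printed); "irreducible" is `Irreducible` in `ℤ[X]`; "pairwise coprime" is `IsCoprime` of the
images in `ℚ[X]`; `‖Q‖ = polyHeight (∏ Qⱼ)`; `𝓜_k` is `IsClassMk`; the `≤ g` integers `n` with
`Q(n) = 0` are omitted from the left sum; the right-hand sum runs over all `nⱼ ≥ 1` with
`∏ nⱼ ≤ ⌊x⌋₊` and drops the coprimality restriction `†` (all terms `≥ 0`, so it dominates
`∑_{n≤x} v(n; F, ρ)` and the statement is WEAKER than printed).  The general theorem (arbitrary
`Qⱼ`, `v` through the factorisation (9) p. 123) is not rendered.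
-- TODO(general form): arbitrary (not necessarily irreducible, pairwise coprime) `Qⱼ`, with
-- `v(n; F, ρ)` defined through the factorisation (9) p. 123, and constants depending on `Q`
-- only through `(r, g, D)`.
A NAMED FACT, not proved in the tree. [cite: NairTenenbaum1998, Theorem 1 (p. 125); (16) p. 124; §2 p. 123] -/
def NairTenenbaum1998_theorem1_printed : Prop :=
  ∀ (k g : ℕ) (D : ℤ) (A B ε δ : ℝ), 1 ≤ k → 1 ≤ A → 1 ≤ B → 0 < ε →
    ε < 1 / (8 * (g : ℝ) ^ 2) → 0 < δ → δ < 1 →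
    ∃ c₀ C : ℝ, ∀ Q : Fin k → ℤ[X], (∀ j, Irreducible (Q j)) →
      (∀ i j, i ≠ j →
        IsCoprime ((Q i).map (Int.castRingHom ℚ)) ((Q j).map (Int.castRingHom ℚ))) →
      HasNoFixedPrimeDivisor Q → (∏ j, Q j).natDegree = g → (∏ j, Q j).discr = D →
      ∀ F : (Fin k → ℕ) → ℝ, IsClassMk k A B (ε * δ / 3) F →
        ∀ x y : ℝ, c₀ * (polyHeight (∏ j, Q j) : ℝ) ^ δ ≤ x → x ^ (4 * (g : ℝ) ^ 2 * ε) ≤ y →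
          y ≤ x →
          ∑ n ∈ (Finset.Ioc ⌊x⌋₊ ⌊x + y⌋₊).filter (fun n : ℕ => (∏ j, Q j).eval (n : ℤ) ≠ 0),
              F (fun j => ((Q j).eval (n : ℤ)).natAbs) ≤
            C * y * (∏ p ∈ (Finset.Icc 1 ⌊x⌋₊).filter Nat.Prime,
                (1 - (polyRootCountMod Q p : ℝ) / p)) *
              ∑ n ∈ (Fintype.piFinset fun _ : Fin k => Finset.Icc 1 ⌊x⌋₊).filter
                  (fun n => ∏ j, n j ≤ ⌊x⌋₊),
                F n * ∏ j, ((polyRootCountMod ![Q j] (n j) : ℝ) / (n j))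

/-- **The printed Theorem 1 yields Henriot's form on `0 < α < 1/2`** — the body of the (misstated)
`NairTenenbaum1998_theorem1` with `α < 1` replaced by `α < 1/2`; this is
`NairTenenbaum1998_theorem1.henriotForm_of_printed` applied to the named fact.
[cite: NairTenenbaum1998, Theorem 1 (p. 125); Henriot2012, Thm. 1 (range corrected)] -/
theorem NairTenenbaum1998_theorem1_printed.henriotForm (h : NairTenenbaum1998_theorem1_printed) :
    ∀ (k g : ℕ) (D : ℤ) (A B α δ ε : ℝ), 1 ≤ k → 1 ≤ A → 1 ≤ B → 0 < α → α < 1 / 2 → 0 < δ →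
    δ < 1 → 0 < ε → ε ≤ α * δ / (12 * (g : ℝ) ^ 2) →
    ∃ c₀ C : ℝ, ∀ Q : Fin k → ℤ[X], (∀ j, Irreducible (Q j)) →
      (∀ i j, i ≠ j → IsCoprime ((Q i).map (Int.castRingHom ℚ)) ((Q j).map (Int.castRingHom ℚ))) →
      HasNoFixedPrimeDivisor Q → (∏ j, Q j).natDegree = g → (∏ j, Q j).discr = D →
      ∀ F : (Fin k → ℕ) → ℝ, IsClassMk k A B ε F →
        ∀ x y : ℝ, c₀ * (polyHeight (∏ j, Q j) : ℝ) ^ δ ≤ x → x ^ α < y → y ≤ x →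
          ∑ n ∈ (Finset.Ioc ⌊x⌋₊ ⌊x + y⌋₊).filter (fun n : ℕ => (∏ j, Q j).eval (n : ℤ) ≠ 0),
              F (fun j => ((Q j).eval (n : ℤ)).natAbs) ≤
            C * y * (∏ p ∈ (Finset.Icc 1 ⌊x⌋₊).filter Nat.Prime,
                (1 - (polyRootCountMod Q p : ℝ) / p)) *
              ∑ n ∈ (Fintype.piFinset fun _ : Fin k => Finset.Icc 1 ⌊x⌋₊).filter
                  (fun n => ∏ j, n j ≤ ⌊x⌋₊),
                F n * ∏ j, ((polyRootCountMod ![Q j] (n j) : ℝ) / (n j)) :=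
  NairTenenbaum1998_theorem1.henriotForm_of_printed h

end Literature.NumberTheory.Sieve

end
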